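import Mathlib
import HarnessLib
import Summits.NavierStokesRegularity.NavierStokesRegularity.Theorems.PoloidalWindowDoorLrcModEntireQuarticMax

/-!
# Route `PoloidalWindowDoor`, item `LrcModEntire` (stmt-NavierStokesRegularity-20428) / crux K2 (stmt-19708) —
# RADIAL NEGATIVITY at a quartic-nondegenerate flat critical point (star-shaped leaves for the flat thick residue S3′, case (a))

LEAD of item 20428 ns-poloidal-K2-p3 g10 (`--supports stmt-NavierStokesRegularity-20428 --as helper`).
Sequel of `…QuarticMax` (strict maximum).  Under the same jet hypotheses at `0` along `p, q` and the (slightly stronger) discriminant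
condition `27B² < 8AQ`, the RADIAL derivative is negative on a punctured plane neighbourhood: `Dg(xp + yq)(xp + yq) < 0` — the hypothesis
of `…RadialLevels.strictAntiOn_ray_of_radial_neg` / `existsUnique_level_on_ray` (one crossing per ray ⇒ the leaves `{g = c}` are radial
graphs, i.e. closed star-shaped curves about the thread, WITHOUT the Morse hypothesis).  Expansion used:
`Dg(xp+yq)(xp+yq) = A x² + (3/2)B x y² + (Q/6) y⁴ + o(x² + y⁴)`, from `Dg(z)z = x·Dg(z)p + y·Dg(z)q`, the mean value theorem in `x`,
one-variable Taylor in `y`, continuity of `D²g` and Fréchet differentiability of `z ↦ D²g(z)[p,q]` at `0`; general real normed space, `g ∈ C³`… `C⁴`.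
* `mvt_along`, `taylor_littleO_three`, `exists_margin_radial` — tools;  * `quarticRadialNeg` — the theorem.
WHAT THIS IS NOT: not S3′, not a claim about Navier–Stokes regularity — calculus (bears_on LADDER-NS N0, rung N0-LocalTubeDoorPoloidal). [folklore]
-/

noncomputable section

-- the summit and its single sub-problem share the name (CONVENTIONS §1), as in every Theorems file
set_option linter.dupNamespace false

namespace Summit.NavierStokesRegularity.NavierStokesRegularity.Theorems.PoloidalWindowDoorLrcModEntireQuarticRadial

open Set Filter Topology Metric Asymptotics
open Summit.NavierStokesRegularity.NavierStokesRegularity.Theorems.PoloidalWindowDoorLrcModEntireQuarticMax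

/-! ### One-variable tools -/

/-- Mean value form about `0`: `f x = f 0 + f'(ξ) x` for some `ξ` strictly between `0` and `x`. [folklore] -/
theorem mvt_zero {f : ℝ → ℝ} (hf : ContDiff ℝ 1 f) {x : ℝ} (hx : x ≠ 0) :
    ∃ ξ ∈ uIoo 0 x, f x = f 0 + deriv f ξ * x := by
  obtain ⟨ξ, hξ, h⟩ := taylor_mean_remainder_lagrange_iteratedDeriv (n := 0) hx.symm (hf.contDiffOn)
  refine ⟨ξ, hξ, ?_⟩
  rw [taylor_within_zero_eval, iteratedDeriv_one] at h
  have : f x = f 0 + deriv f ξ * (x - 0) ^ 1 / (0 + 1).factorial := by linarith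
  rw [this]; norm_num [Nat.factorial]

/-- Third-order little-o Taylor about `0` with `f'(0) = f''(0) = 0`: `|f y − f 0 − f‴(0) y³/6| ≤ ε |y|³` near `0`. [folklore] -/
theorem taylor_littleO_three {f : ℝ → ℝ} (hf : ContDiff ℝ 3 f) (h1 : deriv f 0 = 0) (h2 : iteratedDeriv 2 f 0 = 0)
    {ε : ℝ} (hε : 0 < ε) :
    ∃ δ > 0, ∀ y : ℝ, |y| < δ → |f y - f 0 - iteratedDeriv 3 f 0 * y ^ 3 / 6| ≤ ε * |y| ^ 3 := by
  have hT : ∀ y : ℝ, taylorWithinEval f 3 univ 0 y = f 0 + iteratedDeriv 3 f 0 * y ^ 3 / 6 := by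
    intro y
    rw [taylor_within_apply]
    simp only [Finset.sum_range_succ, Finset.sum_range_zero, Nat.factorial, sub_zero, iteratedDerivWithin_univ,
      iteratedDeriv_zero, iteratedDeriv_one, h1, h2, smul_eq_mul]
    norm_num
    ring
  have hlo := (taylor_isLittleO_univ (n := 3) (x₀ := 0) hf).def hε
  obtain ⟨δ, hδ, hball⟩ := Metric.eventually_nhds_iff.1 hlo
  refine ⟨δ, hδ, fun y hy => ?_⟩
  have h := hball (show dist y 0 < δ by simpa using hy)
  rw [hT, ← sub_sub] at h
  simpa [Real.norm_eq_abs, sub_zero, abs_pow] using h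

/-- The margin for the radial form `A X² + (3|B|/2) X Y + (Q/6) Y²` under `27B² < 8AQ`. [folklore] -/
theorem exists_margin_radial {A B Q : ℝ} (P R : ℝ) (hA : A < 0) (hQ : Q < 0) (hdisc : 27 * B ^ 2 < 8 * A * Q) :
    ∃ ε > 0, 0 < 4 * (A + (2 + P) * ε) * (Q / 6 + ε) - (3 * |B| / 2 + (1 + R) * ε) ^ 2 ∧
      A + (2 + P) * ε < 0 ∧ Q / 6 + ε < 0 ∧ ε ≤ 1 := by
  have hΦc : Continuous fun e : ℝ => 4 * (A + (2 + P) * e) * (Q / 6 + e) - (3 * |B| / 2 + (1 + R) * e) ^ 2 := by fun_prop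
  have hΦ0 : (0 : ℝ) < 4 * (A + (2 + P) * 0) * (Q / 6 + 0) - (3 * |B| / 2 + (1 + R) * 0) ^ 2 := by
    have hB2 : |B| ^ 2 = B ^ 2 := sq_abs B
    nlinarith [hdisc, hB2]
  have hev : ∀ᶠ e in 𝓝 (0 : ℝ), (0 < 4 * (A + (2 + P) * e) * (Q / 6 + e) - (3 * |B| / 2 + (1 + R) * e) ^ 2) ∧
      (A + (2 + P) * e < 0 ∧ (Q / 6 + e < 0 ∧ e < 1)) := by
    refine (continuousAt_const.eventually_lt hΦc.continuousAt hΦ0).and (Filter.Eventually.and ?_ (Filter.Eventually.and ?_ ?_))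
    · exact (by fun_prop : Continuous fun e : ℝ => A + (2 + P) * e).continuousAt.eventually_lt continuousAt_const
        (by simpa using hA)
    · exact (by fun_prop : Continuous fun e : ℝ => Q / 6 + e).continuousAt.eventually_lt continuousAt_const
        (by simp only [add_zero]; linarith)
    · exact continuousAt_id.eventually_lt continuousAt_const (by norm_num)
  obtain ⟨r, hr, hrball⟩ := Metric.eventually_nhds_iff.1 hev
  have hεr : dist (r / 2) 0 < r := by rw [Real.dist_eq, sub_zero, abs_of_pos (by linarith)]; linarith
  obtain ⟨h1, h2, h3, h4⟩ := hrball hεr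
  exact ⟨r / 2, by linarith, h1, h2, h3, h4.le⟩

/-! ### Along-the-plane bookkeeping -/

section Plane

variable {E : Type*} [NormedAddCommGroup E] [NormedSpace ℝ E]

/-- `s ↦ Dg(sp + yq)w` has derivative `D²g(sp + yq)[p,w]`. [folklore] -/
theorem hasDerivAt_fderiv_along {g : E → ℝ} (hg : ContDiff ℝ 2 g) (p q w : E) (y s : ℝ) :
    HasDerivAt (fun s : ℝ => fderiv ℝ g (s • p + y • q) w) (iteratedFDeriv ℝ 2 g (s • p + y • q) ![p, w]) s := by
  have hd2 : Differentiable ℝ (fderiv ℝ g) := (hg.fderiv_right (m := 1) (by norm_num)).differentiable (by norm_num)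
  have hline : HasDerivAt (fun s : ℝ => s • p + y • q) p s := by
    simpa using ((hasDerivAt_id s).smul_const p).add_const (y • q)
  have hc : HasDerivAt (fun s : ℝ => fderiv ℝ g (s • p + y • q)) (fderiv ℝ (fderiv ℝ g) (s • p + y • q) p) s :=
    (hd2 _).hasFDerivAt.comp_hasDerivAt s hline
  have h := hc.clm_apply (hasDerivAt_const s w)
  rw [iteratedFDeriv_two_apply]
  simpa using h

/-- Mean value in `x` of `Dg(·)w` along `p` at height `yq`. [folklore] -/
theorem mvt_fderiv_along {g : E → ℝ} (hg : ContDiff ℝ 2 g) (p q w : E) (y : ℝ) {x : ℝ} (hx : x ≠ 0) :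
    ∃ ξ ∈ uIoo 0 x, fderiv ℝ g (x • p + y • q) w = fderiv ℝ g (y • q) w + iteratedFDeriv ℝ 2 g (ξ • p + y • q) ![p, w] * x := by
  have hfc : ContDiff ℝ 1 (fun s : ℝ => fderiv ℝ g (s • p + y • q) w) :=
    ((hg.fderiv_right (m := 1) (by norm_num)).comp ((contDiff_id.smul contDiff_const).add contDiff_const)).clm_apply
      contDiff_const
  obtain ⟨ξ, hξ, h⟩ := mvt_zero hfc hx
  refine ⟨ξ, hξ, ?_⟩
  rw [(hasDerivAt_fderiv_along hg p q w y ξ).deriv] at h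
  simpa using h

/-- The derivative ALONG `q` of the mixed entry `z ↦ D²g(z)[p,q]` at `0` is `B = (d²/dy²)|₀ Dg(yq)p`. [folklore] -/
theorem fderiv_mixed_apply_q {g : E → ℝ} (hg : ContDiff ℝ 3 g) (p q : E) :
    fderiv ℝ (fun z : E => fderiv ℝ (fderiv ℝ g) z p q) 0 q = iteratedDeriv 2 (fun y : ℝ => fderiv ℝ g (y • q) p) 0 := by
  have hg2 : ContDiff ℝ 2 g := hg.of_le (by norm_num)
  have hd2 : Differentiable ℝ (fderiv ℝ (fderiv ℝ g)) :=
    (hg.fderiv_right (m := 2) (by norm_num)).fderiv_right (m := 1) (by norm_num) |>.differentiable (by norm_num)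
  have hKd : ∀ z : E, DifferentiableAt ℝ (fun z : E => fderiv ℝ (fderiv ℝ g) z p q) z := fun z =>
    (((hd2 z).clm_apply (differentiableAt_const p)).clm_apply (differentiableAt_const q))
  have hsymm : ∀ z : E, fderiv ℝ (fderiv ℝ g) z p q = fderiv ℝ (fderiv ℝ g) z q p :=
    fun z => (hg2.contDiffAt.isSymmSndFDerivAt (by simp)) p q
  have hF1' : ∀ y : ℝ, deriv (fun y : ℝ => fderiv ℝ g (y • q) p) y = fderiv ℝ (fderiv ℝ g) (y • q) p q := by
    intro y
    rw [(hasDerivAt_fderiv_line_apply hg2 p q y).deriv, iteratedFDeriv_two_apply]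
    simp [hsymm]
  have hline : HasDerivAt (fun y : ℝ => y • q) q 0 := by simpa using (hasDerivAt_id (0 : ℝ)).smul_const q
  have h0 : HasFDerivAt (fun z : E => fderiv ℝ (fderiv ℝ g) z p q)
      (fderiv ℝ (fun z : E => fderiv ℝ (fderiv ℝ g) z p q) 0) ((0 : ℝ) • q) := by
    simpa using (hKd 0).hasFDerivAt
  have hc := h0.comp_hasDerivAt (0 : ℝ) hline
  rw [← hc.deriv]
  have hfun : ((fun z : E => fderiv ℝ (fderiv ℝ g) z p q) ∘ fun y : ℝ => y • q) =
      deriv (fun y : ℝ => fderiv ℝ g (y • q) p) := funext fun y => (hF1' y).symm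
  rw [hfun, iteratedDeriv_succ, iteratedDeriv_one]

/-- Jets of `G₁ : y ↦ Dg(yq)q` at a flat critical point: `C³`, `G₁(0) = G₁'(0) = G₁''(0) = 0`, `G₁‴(0) = D⁴g(0)[q⁴]`. [folklore] -/
theorem G1_jets {g : E → ℝ} (hg : ContDiff ℝ 4 g) (p q : E) (h1 : fderiv ℝ g 0 = 0)
    (hker : ∀ w : E, iteratedFDeriv ℝ 2 g 0 ![q, w] = 0) (h3 : iteratedFDeriv ℝ 3 g 0 (fun _ => q) = 0) :
    ContDiff ℝ 3 (fun y : ℝ => fderiv ℝ g (y • q) q) ∧ fderiv ℝ g ((0 : ℝ) • q) q = 0 ∧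
      deriv (fun y : ℝ => fderiv ℝ g (y • q) q) 0 = 0 ∧ iteratedDeriv 2 (fun y : ℝ => fderiv ℝ g (y • q) q) 0 = 0 ∧
      iteratedDeriv 3 (fun y : ℝ => fderiv ℝ g (y • q) q) 0 = iteratedFDeriv ℝ 4 g 0 (fun _ => q) := by
  have hg2 : ContDiff ℝ 2 g := hg.of_le (by norm_num)
  obtain ⟨⟨-, hF0d2, hF0d3, hF0d4⟩, -, -⟩ := line_jets hg p q h1 hker h3
  have hF0c : ContDiff ℝ 4 (fun y : ℝ => g (y • q)) := hg.comp (contDiff_id.smul contDiff_const)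
  have hG1 : ∀ y : ℝ, deriv (fun y : ℝ => g (y • q)) y = fderiv ℝ g (y • q) q := by
    intro y
    have hline : HasDerivAt (fun y : ℝ => y • q) q y := by simpa using (hasDerivAt_id y).smul_const q
    exact (((hg2.differentiable (by norm_num)) (y • q)).hasFDerivAt.comp_hasDerivAt y hline).deriv
  have hG1fun : (fun y : ℝ => fderiv ℝ g (y • q) q) = deriv (fun y : ℝ => g (y • q)) := funext fun y => (hG1 y).symm
  refine ⟨?_, by simp [h1], ?_, ?_, ?_⟩
  · rw [hG1fun]; exact hF0c.deriv'
  · rw [hG1fun, ← iteratedDeriv_one, ← iteratedDeriv_succ', hF0d2]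
  · rw [hG1fun, ← iteratedDeriv_succ', hF0d3]
  · rw [hG1fun, ← iteratedDeriv_succ', hF0d4]

/-- Norm control along the plane: `|ξ| ≤ |x| < κ/(‖p‖+‖q‖+1)`, `|y| < κ/(‖p‖+‖q‖+1)` ⇒ `‖ξp + yq‖ < κ`. [folklore] -/
theorem norm_along_lt (p q : E) {κ x y ξ : ℝ} (hκ : 0 < κ) (hx : |x| < κ / (‖p‖ + ‖q‖ + 1))
    (hy : |y| < κ / (‖p‖ + ‖q‖ + 1)) (hξ : |ξ| ≤ |x|) :
    ‖ξ • p + y • q‖ < κ ∧ ‖ξ • p + y • q‖ ≤ |ξ| * ‖p‖ + |y| * ‖q‖ := by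
  have hS : (0 : ℝ) < ‖p‖ + ‖q‖ + 1 := by positivity
  have hρ' : κ / (‖p‖ + ‖q‖ + 1) * (‖p‖ + ‖q‖ + 1) = κ := div_mul_cancel₀ _ hS.ne'
  have hle : ‖ξ • p + y • q‖ ≤ |ξ| * ‖p‖ + |y| * ‖q‖ := by
    calc ‖ξ • p + y • q‖ ≤ ‖ξ • p‖ + ‖y • q‖ := norm_add_le _ _
      _ = |ξ| * ‖p‖ + |y| * ‖q‖ := by rw [norm_smul, norm_smul, Real.norm_eq_abs, Real.norm_eq_abs]
  refine ⟨?_, hle⟩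
  have hpos : 0 < κ / (‖p‖ + ‖q‖ + 1) := div_pos hκ hS
  calc ‖ξ • p + y • q‖ ≤ |ξ| * ‖p‖ + |y| * ‖q‖ := hle
    _ ≤ κ / (‖p‖ + ‖q‖ + 1) * ‖p‖ + κ / (‖p‖ + ‖q‖ + 1) * ‖q‖ :=
        add_le_add (mul_le_mul_of_nonneg_right (hξ.trans hx.le) (norm_nonneg _))
          (mul_le_mul_of_nonneg_right hy.le (norm_nonneg _))
    _ = κ / (‖p‖ + ‖q‖ + 1) * (‖p‖ + ‖q‖ + 1) - κ / (‖p‖ + ‖q‖ + 1) := by ring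
    _ < κ := by rw [hρ']; linarith

/-- The pure-real assembly of the radial expansion: with all analytic bounds as hypotheses, the radial derivative is negative.
[folklore] -/
theorem radial_algebra {x y ξ' A B Q B' ε P R F H G K : ℝ} (hx : x ≠ 0) (hε : 0 < ε) (hP : 0 ≤ P)
    (hy1 : |y| ≤ 1) (hyB : |B'| * |y| ≤ ε) (hξ' : |ξ'| ≤ |x|)
    (hF : |F| ≤ |B| / 2 * y ^ 2 + ε * y ^ 2) (hH : H ≤ A + ε) (hyG : y * G ≤ (Q / 6 + ε) * y ^ 4)
    (hK : |K - (B' * ξ' + B * y)| ≤ ε * (|ξ'| * P + |y| * R))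
    (hform : 0 < 4 * (A + (2 + P) * ε) * (Q / 6 + ε) - (3 * |B| / 2 + (1 + R) * ε) ^ 2)
    (hAε : A + (2 + P) * ε < 0) :
    x * (F + H * x) + y * (G + K * x) < 0 := by
  have hxpos : 0 < |x| := abs_pos.2 hx
  have hx2 : 0 < x ^ 2 := by positivity
  have hxx : |x| * |x| = x ^ 2 := by rw [← sq_abs, sq]
  have hyy : |y| * |y| = y ^ 2 := by rw [← sq_abs, sq]
  -- x F
  have t0 : x * F ≤ (|B| / 2 + ε) * (|x| * y ^ 2) := by
    calc x * F ≤ |x * F| := le_abs_self _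
      _ = |x| * |F| := abs_mul _ _
      _ ≤ |x| * (|B| / 2 * y ^ 2 + ε * y ^ 2) := mul_le_mul_of_nonneg_left hF (abs_nonneg x)
      _ = (|B| / 2 + ε) * (|x| * y ^ 2) := by ring
  -- x H x
  have t1 : x * (H * x) ≤ (A + ε) * x ^ 2 := by
    have : x * (H * x) = H * x ^ 2 := by ring
    rw [this]; exact mul_le_mul_of_nonneg_right hH hx2.le
  -- y K x = B x y² + x y B' ξ' + x y (K − B'ξ' − B y)
  have e0 : y * (K * x) = B * (x * y ^ 2) + (x * y) * (B' * ξ') + (x * y) * (K - (B' * ξ' + B * y)) := by ring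
  have t2 : B * (x * y ^ 2) ≤ |B| * (|x| * y ^ 2) := by
    calc B * (x * y ^ 2) ≤ |B * (x * y ^ 2)| := le_abs_self _
      _ = |B| * (|x| * y ^ 2) := by rw [abs_mul, abs_mul, abs_of_nonneg (sq_nonneg y)]
  have t3 : (x * y) * (B' * ξ') ≤ ε * x ^ 2 := by
    calc (x * y) * (B' * ξ') ≤ |(x * y) * (B' * ξ')| := le_abs_self _
      _ = |x| * (|B'| * |y|) * |ξ'| := by rw [abs_mul, abs_mul, abs_mul]; ring
      _ ≤ |x| * ε * |x| := by
          exact mul_le_mul (mul_le_mul_of_nonneg_left hyB (abs_nonneg x)) hξ' (abs_nonneg _)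
            (mul_nonneg (abs_nonneg _) hε.le)
      _ = ε * x ^ 2 := by rw [← hxx]; ring
  have t4 : (x * y) * (K - (B' * ξ' + B * y)) ≤ P * ε * x ^ 2 + R * ε * (|x| * y ^ 2) := by
    calc (x * y) * (K - (B' * ξ' + B * y)) ≤ |(x * y) * (K - (B' * ξ' + B * y))| := le_abs_self _
      _ = |x| * |y| * |K - (B' * ξ' + B * y)| := by rw [abs_mul, abs_mul]
      _ ≤ |x| * |y| * (ε * (|ξ'| * P + |y| * R)) :=
          mul_le_mul_of_nonneg_left hK (mul_nonneg (abs_nonneg _) (abs_nonneg _))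
      _ = ε * P * (|x| * (|y| * |ξ'|)) + R * ε * (|x| * (|y| * |y|)) := by ring
      _ ≤ ε * P * (|x| * (1 * |x|)) + R * ε * (|x| * (|y| * |y|)) := by
          have h : |y| * |ξ'| ≤ 1 * |x| := mul_le_mul hy1 hξ' (abs_nonneg _) zero_le_one
          have h' : |x| * (|y| * |ξ'|) ≤ |x| * (1 * |x|) := mul_le_mul_of_nonneg_left h (abs_nonneg x)
          have h'' : ε * P * (|x| * (|y| * |ξ'|)) ≤ ε * P * (|x| * (1 * |x|)) :=
            mul_le_mul_of_nonneg_left h' (mul_nonneg hε.le hP)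
          linarith
      _ = P * ε * x ^ 2 + R * ε * (|x| * y ^ 2) := by rw [hyy, one_mul, hxx]; ring
  -- total
  have hsum : x * (F + H * x) + y * (G + K * x) ≤
      (A + (2 + P) * ε) * |x| ^ 2 + (3 * |B| / 2 + (1 + R) * ε) * (|x| * y ^ 2) + (Q / 6 + ε) * (y ^ 2) ^ 2 := by
    have e1 : x * (F + H * x) + y * (G + K * x) = x * F + x * (H * x) + y * G + y * (K * x) := by ring
    rw [e1, e0, sq_abs]
    have hy4 : (y ^ 2) ^ 2 = y ^ 4 := by ring
    rw [hy4]
    linarith [t0, t1, t2, t3, t4, hyG]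
  have key := form_neg_of_negdef (a := A + (2 + P) * ε) (b := 3 * |B| / 2 + (1 + R) * ε) (c := Q / 6 + ε)
    hAε (by linarith [hform]) hxpos (sq_nonneg y)
  linarith [hsum, key]

/-- **RADIAL NEGATIVITY AT A QUARTIC-NONDEGENERATE FLAT CRITICAL POINT.**  `g ∈ C⁴` on a real normed space, directions `p, q`; at `0`:
`Dg(0) = 0`, `q ∈ ker D²g(0)`, `A := D²g(0)[p,p] < 0`, `D³g(0)[q,q,q] = 0`, `Q := D⁴g(0)[q,q,q,q] < 0` and `27B² < 8AQ` for
`B := (d²/dy²)|₀ Dg(yq)p = D³g(0)[p,q,q]`.  Then `Dg(z)z < 0` for all small `z = xp + yq ≠ 0`. [folklore] -/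
theorem quarticRadialNeg {g : E → ℝ} (hg : ContDiff ℝ 4 g) (p q : E) (h1 : fderiv ℝ g 0 = 0)
    (hker : ∀ w : E, iteratedFDeriv ℝ 2 g 0 ![q, w] = 0) (hA : iteratedFDeriv ℝ 2 g 0 ![p, p] < 0)
    (h3 : iteratedFDeriv ℝ 3 g 0 (fun _ => q) = 0) (hQ : iteratedFDeriv ℝ 4 g 0 (fun _ => q) < 0)
    (hdisc : 27 * (iteratedDeriv 2 (fun y : ℝ => fderiv ℝ g (y • q) p) 0) ^ 2 <
      8 * iteratedFDeriv ℝ 2 g 0 ![p, p] * iteratedFDeriv ℝ 4 g 0 (fun _ => q)) :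
    ∃ ρ > 0, ∀ x y : ℝ, |x| < ρ → |y| < ρ → (x ≠ 0 ∨ y ≠ 0) →
      fderiv ℝ g (x • p + y • q) (x • p + y • q) < 0 := by
  obtain ⟨A, hAdef⟩ : ∃ A, A = iteratedFDeriv ℝ 2 g 0 ![p, p] := ⟨_, rfl⟩
  obtain ⟨Q, hQdef⟩ : ∃ Q, Q = iteratedFDeriv ℝ 4 g 0 (fun _ => q) := ⟨_, rfl⟩
  obtain ⟨B, hBdef⟩ : ∃ B, B = iteratedDeriv 2 (fun y : ℝ => fderiv ℝ g (y • q) p) 0 := ⟨_, rfl⟩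
  rw [← hAdef] at hA hdisc
  rw [← hQdef] at hQ hdisc
  rw [← hBdef] at hdisc
  have hg2 : ContDiff ℝ 2 g := hg.of_le (by norm_num)
  have hg3 : ContDiff ℝ 3 g := hg.of_le (by norm_num)
  -- the mixed entry `K z := D²g(z)[p,q]`: derivative `K'` at `0`, `K' q = B`, `B' := K' p`
  have hd2 : Differentiable ℝ (fderiv ℝ (fderiv ℝ g)) :=
    (hg.fderiv_right (m := 2) (by norm_num)).fderiv_right (m := 1) (by norm_num) |>.differentiable (by norm_num)
  have hKd : DifferentiableAt ℝ (fun z : E => fderiv ℝ (fderiv ℝ g) z p q) 0 :=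
    (((hd2 0).clm_apply (differentiableAt_const p)).clm_apply (differentiableAt_const q))
  obtain ⟨K', hK'⟩ : ∃ K' : E →L[ℝ] ℝ, K' = fderiv ℝ (fun z : E => fderiv ℝ (fderiv ℝ g) z p q) 0 := ⟨_, rfl⟩
  have hKo := hasFDerivAt_iff_isLittleO_nhds_zero.1 (hK' ▸ hKd.hasFDerivAt)
  have hKq : K' q = B := by rw [hK', hBdef]; exact fderiv_mixed_apply_q hg3 p q
  obtain ⟨B', hB'def⟩ : ∃ B' : ℝ, B' = K' p := ⟨_, rfl⟩
  -- Step 0: margin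
  obtain ⟨ε, hε, hΦε, hAε, hQε, hε1⟩ := exists_margin_radial ‖p‖ ‖q‖ hA hQ hdisc
  -- Step 1: jets and Taylor bounds of the line functions
  obtain ⟨-, hF1c, hF1d1⟩ := line_jets hg p q h1 hker h3
  obtain ⟨hG1c, hG1d0, hG1d1, hG1d2, hG1d3⟩ := G1_jets hg p q h1 hker h3
  rw [← hQdef] at hG1d3
  obtain ⟨δ₀, hδ₀, hT0⟩ := taylor_littleO_three hG1c hG1d1 hG1d2 hε
  obtain ⟨δ₁, hδ₁, hT1⟩ := taylor_littleO_two hF1c hF1d1 hε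
  -- Step 2: Hessian control and the little-o of `K`
  obtain ⟨η, hη, hH⟩ := hessian_apply_le_near hg2 p hε
  rw [← hAdef] at hH
  obtain ⟨η', hη', hKball⟩ := Metric.eventually_nhds_iff.1 (hKo.def hε)
  -- Step 3: radius
  have hS : (0 : ℝ) < ‖p‖ + ‖q‖ + 1 := by positivity
  have hBp : (0 : ℝ) < |B'| + 1 := by positivity
  refine ⟨min (min (min δ₀ δ₁) (min η η' / (‖p‖ + ‖q‖ + 1))) (ε / (|B'| + 1)),
    lt_min (lt_min (lt_min hδ₀ hδ₁) (div_pos (lt_min hη hη') hS)) (div_pos hε hBp), fun x y hx hy hxy => ?_⟩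
  have hyδ₀ : |y| < δ₀ := hy.trans_le ((min_le_left _ _).trans ((min_le_left _ _).trans (min_le_left _ _)))
  have hyδ₁ : |y| < δ₁ := hy.trans_le ((min_le_left _ _).trans ((min_le_left _ _).trans (min_le_right _ _)))
  have hxη : |x| < min η η' / (‖p‖ + ‖q‖ + 1) := hx.trans_le ((min_le_left _ _).trans (min_le_right _ _))
  have hyη : |y| < min η η' / (‖p‖ + ‖q‖ + 1) := hy.trans_le ((min_le_left _ _).trans (min_le_right _ _))
  have hyB' : |y| < ε / (|B'| + 1) := hy.trans_le (min_le_right _ _)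
  have hy1 : |y| ≤ 1 := by
    have : ε / (|B'| + 1) ≤ 1 := by rw [div_le_one hBp]; linarith [abs_nonneg B']
    exact (hyB'.le.trans this)
  have hyB : |B'| * |y| ≤ ε := by
    have h : |B'| * |y| ≤ (|B'| + 1) * (ε / (|B'| + 1)) := mul_le_mul (by linarith) hyB'.le (abs_nonneg y) hBp.le
    rwa [mul_div_cancel₀ _ hBp.ne'] at h
  -- Dg(z)z = x·Dg(z)p + y·Dg(z)q
  have hsplit : fderiv ℝ g (x • p + y • q) (x • p + y • q) =
      x * fderiv ℝ g (x • p + y • q) p + y * fderiv ℝ g (x • p + y • q) q := by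
    simp only [map_add, map_smul, smul_eq_mul]
  -- the `y G₁(y)` piece
  have hyG : y * fderiv ℝ g (y • q) q ≤ (Q / 6 + ε) * y ^ 4 := by
    have h := hT0 y hyδ₀
    rw [hG1d0, hG1d3, sub_zero] at h
    have hy3 : |y| * (ε * |y| ^ 3) = ε * y ^ 4 := by
      have : |y| ^ 4 = y ^ 4 := by rw [← abs_pow]; exact abs_of_nonneg (by positivity)
      rw [← this]; ring
    have key : y * (fderiv ℝ g (y • q) q - Q * y ^ 3 / 6) ≤ |y| * (ε * |y| ^ 3) := by
      calc y * (fderiv ℝ g (y • q) q - Q * y ^ 3 / 6) ≤ |y * (fderiv ℝ g (y • q) q - Q * y ^ 3 / 6)| := le_abs_self _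
        _ = |y| * |fderiv ℝ g (y • q) q - Q * y ^ 3 / 6| := abs_mul _ _
        _ ≤ |y| * (ε * |y| ^ 3) := mul_le_mul_of_nonneg_left h (abs_nonneg y)
    rw [hy3] at key
    have e2 : y * (Q * y ^ 3 / 6) = Q / 6 * y ^ 4 := by ring
    linarith [key, e2]
  rcases eq_or_ne x 0 with hx0 | hx0
  · -- x = 0
    subst hx0
    have hy0 : y ≠ 0 := by
      rcases hxy with h | h
      · exact absurd rfl h
      · exact h
    have hy4 : 0 < y ^ 4 := by positivity
    rw [hsplit]
    simp only [zero_smul, zero_add, zero_mul]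
    nlinarith [hyG, hQε, hy4]
  · -- x ≠ 0 : mean value in `x` for both pieces
    obtain ⟨ξ, hξ, hP⟩ := mvt_fderiv_along hg2 p q p y hx0
    obtain ⟨ξ', hξ', hSq⟩ := mvt_fderiv_along hg2 p q q y hx0
    have hξx : |ξ| ≤ |x| := (abs_lt_of_mem_uIoo hξ).le
    have hξ'x : |ξ'| ≤ |x| := (abs_lt_of_mem_uIoo hξ').le
    have hzξ := norm_along_lt p q (lt_min hη hη') hxη hyη hξx
    have hzξ' := norm_along_lt p q (lt_min hη hη') hxη hyη hξ'x
    have hHb : iteratedFDeriv ℝ 2 g (ξ • p + y • q) ![p, p] ≤ A + ε := hH _ (hzξ.1.trans_le (min_le_left _ _))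
    have hF1b : |fderiv ℝ g (y • q) p| ≤ |B| / 2 * y ^ 2 + ε * y ^ 2 := by
      have h := hT1 y hyδ₁
      simp only [zero_smul, h1, zero_apply, sub_zero, ← hBdef] at h
      have h' : |fderiv ℝ g (y • q) p| ≤ |B * y ^ 2 / 2| + ε * y ^ 2 := by
        have := abs_sub_abs_le_abs_sub (fderiv ℝ g (y • q) p) (B * y ^ 2 / 2)
        linarith
      rw [abs_div, abs_mul, abs_of_nonneg (sq_nonneg y), abs_two] at h'
      linarith
    have hKb : |iteratedFDeriv ℝ 2 g (ξ' • p + y • q) ![p, q] - (B' * ξ' + B * y)| ≤ ε * (|ξ'| * ‖p‖ + |y| * ‖q‖) := by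
      have h := hKball (show dist (ξ' • p + y • q) 0 < η' by
        rw [dist_zero_right]; exact hzξ'.1.trans_le (min_le_right _ _))
      simp only [zero_add, Real.norm_eq_abs] at h
      have hKz : K' (ξ' • p + y • q) = B' * ξ' + B * y := by
        rw [map_add, map_smul, map_smul, smul_eq_mul, smul_eq_mul, ← hB'def, hKq]; ring
      have hK0 : fderiv ℝ (fderiv ℝ g) 0 p q = 0 := by
        have h0 := hker p
        rw [iteratedFDeriv_two_apply] at h0
        have hsymm0 : fderiv ℝ (fderiv ℝ g) 0 p q = fderiv ℝ (fderiv ℝ g) 0 q p :=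
          (hg2.contDiffAt (x := (0 : E))).isSymmSndFDerivAt (by simp) p q
        simp only [Matrix.cons_val_zero, Matrix.cons_val_one] at h0
        rw [hsymm0]; exact h0
      rw [hKz, hK0, sub_zero] at h
      rw [iteratedFDeriv_two_apply]
      simp only [Matrix.cons_val_zero, Matrix.cons_val_one]
      exact h.trans (mul_le_mul_of_nonneg_left hzξ'.2 hε.le)
    rw [hsplit, hP, hSq]
    exact radial_algebra hx0 hε (norm_nonneg p) hy1 hyB hξ'x hF1b hHb hyG hKb hΦε hAε

end Plane

end Summit.NavierStokesRegularity.NavierStokesRegularity.Theorems.PoloidalWindowDoorLrcModEntireQuarticRadial
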